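import Summits.QuantumAdvantage.AdviceFreeQNC0.SeedJuntaSlack39
import Summits.QuantumAdvantage.AdviceFreeQNC0.GradedSeeds38JuntaReduction
import HarnessLib

/-!
# Cell qa-qnc0, `p = 3` — the unconditional structured branch (slack form) in the (J3)ˣ format with `r` private forms per output,
# and in WALK coordinates next to `BlockFibre37.PerOutputFormsHardConst` (prover qn-prover-3 g27; sequel of `SeedJuntaSlack39`)

`SeedJuntaSlack39` proved the structured branch of the private-forms programme UNCONDITIONALLY for every read family, with the slack
schedule `N/(log₂N)^E + (log₂N)^{2C+E}·(50(j+1) + D·log₂N)` (`GradedSeeds38.seedJuntaHardXS_slack`), and recorded the `r = 1` linear form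
WITHOUT the canonical guess (`LinJunta39.perOutputForms_structured_slack`, the format of `LinJunta39.perOutputForms_seedSparse`).  The crux-side
class (J3) `BlockFibre37.PerOutputFormsHardConst` (`BlockCombJoin37.lean`) has `r` private forms per output and lives in WALK coordinates; its
x-frame twin (J3)ˣ (`GradedSeeds38.PerOutputFormsSharpX`, `perOutputForms_span`) carries the canonical guess `tGuess x k` XORed onto the output.
This file gives both formats:

* §1 **`GradedSeeds38.perOutputForms_structured_slackX`** — (J3)ˣ format, every `r`: outputs `tGuess x k ⊕ F k (⟨ℓ_{k,1},x⟩, …, ⟨ℓ_{k,r},x⟩)`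
  with ANY decomposition `ℓ_{k,i} = Σ_t a_{k,i,t} c_t + rem_{k,i}` over ONE seed sequence `c` graded-spread outside `W` (slack schedule, budget
  `3·#W + 3·N/(log₂N)^E ≤ N`) and `#(⋃_i supp rem_{k,i} ∖ W) + 2 ≤ (log₂N)^C` for every output `k`: `≤ θ·2^{N−1}` winning odd inputs —
  UNCONDITIONAL, supports otherwise arbitrary (`seedJuntaHardXS_slack` with the juntas `W ∪ {k, k+1} ∪ ⋃_i supp rem_{k,i}`).
* §2 **`GradedSeeds38.perOutputForms_structured_slack_walk`** — the same in WALK coordinates at the ring charge `n + 2`, i.e. literally the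
  class of `BlockFibre37.PerOutputFormsHardConst` (gate sums `Σ_m [xOfU u m]·ℓ g i m` written out, as in `ringGradedSeedsSharp3_walk`):
  `#{u : Fin n → Bool | the walk strategy u ↦ (F g (gateSum (ℓ g i) u)_i)_g wins} ≤ θ·2ⁿ` for every such decomposed family — transport by
  `GradedSeeds38.card_filter_le_card_odd` + `rel_iff_ringWinU` (`tGuess ⊕ tGuess` cancels).

So, at charge `n + 2`, (J3) holds UNCONDITIONALLY on the structured side of the ROUND-37 §3.1 dichotomy run with the slack schedule (Lemma S
relative to `W`: `LinJunta39.exists_seedDecompositionOff_slack`, family index `Fin (n+1) × Fin r` flattened by the user); what is left of (J3) is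
the heavy-remainder case (B) and the other charges.  WHAT THIS IS NOT: no claim at charges `c ≢ n + 2`; nothing on case (B); crux
`stmt-QuantumAdvantage-22907` untouched; no ledger item (D-0168 shelf).
-/

noncomputable section

namespace Summit.QuantumAdvantage.AdviceFreeQNC0

open Finset Literature.Computability.QuantumComplexity Literature.Computability.QuantumComplexity.RingHLF
open Literature.Computability.MetaComplexity

namespace GradedSeeds38

open TwistedJunta36 LinJunta39

/-! ## §1 (J3)ˣ format: `r` private forms per output, canonical guess built in — unconditional -/

/-- The junta `U ∪ W ∪ {k, k+1}` has at most `#U + 2` letters outside the tolerance set `W`. -/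
theorem card_union_tol_pair_sdiff_le {N : ℕ} (U W : Finset (Fin N)) (k : Fin N) :
    ((U ∪ W ∪ {k, nxt k}) \ W).card ≤ U.card + 2 := by
  have hsub : (U ∪ W ∪ {k, nxt k}) \ W ⊆ U ∪ {k, nxt k} := by
    intro m hm
    rw [mem_sdiff, mem_union, mem_union] at hm
    rcases hm with ⟨(h | h) | h, hW⟩
    · exact mem_union_left _ h
    · exact absurd h hW
    · exact mem_union_right _ h
  refine (card_le_card hsub).trans ((card_union_le _ _).trans ?_)
  have h2 : ({k, nxt k} : Finset (Fin N)).card ≤ 2 := card_insert_le _ _ |>.trans (by simp)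
  omega

/-- The canonical guess `tGuess x k = x_k ⊕ x_{k+1}` only reads the letters `k`, `k+1`. -/
theorem tGuess_congr {N : ℕ} {x x' : Fin N → Bool} (k : Fin N) (hk : x k = x' k) (hk' : x (nxt k) = x' (nxt k)) :
    tGuess x k = tGuess x' k := by
  unfold tGuess
  rw [hk, hk']

open scoped Classical in
/-- ★ **(J3)ˣ, STRUCTURED BRANCH, `r` PRIVATE FORMS PER OUTPUT — UNCONDITIONAL (slack form).**  For every `E`: ONE `θ < 1`, and for every `C`
constants `D, n₀`, such that for `N ≥ n₀`: every strategy `x ↦ tGuess x k ⊕ F k (⟨ℓ_{k,1},x⟩, …, ⟨ℓ_{k,r},x⟩)` whose private forms decompose as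
`ℓ_{k,i} = Σ_t a_{k,i,t} c_t + rem_{k,i}` over a seed sequence `c` graded-spread outside `W` (`3·#W + 3·N/(log₂N)^E ≤ N`) with the slack schedule
`N/(log₂N)^E + (log₂N)^{2C+E}·(50(j+1) + D·log₂N)`, and with `#(⋃_i supp rem_{k,i} ∖ W) + 2 ≤ (log₂N)^C` for every `k` (supports otherwise
arbitrary), wins on `≤ θ·2^{N−1}` odd inputs.  (`seedJuntaHardXS_slack` for the juntas `W ∪ {k, k+1} ∪ ⋃_i suppOff W rem_{k,i}`.) -/
theorem perOutputForms_structured_slackX (E : ℕ) :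
    ∃ θ : ℝ, θ < 1 ∧ ∀ C : ℕ, ∃ D n₀ : ℕ, ∀ N ≥ n₀,
      ∀ (W : Finset (Fin N)) (r : ℕ) (ℓ : Fin N → Fin r → Fin N → ZMod 3) (F : Fin N → (Fin r → ZMod 3) → Bool)
        (R : ℕ) (c : Fin R → Fin N → ZMod 3) (a : Fin N → Fin r → Fin R → ZMod 3) (rem : Fin N → Fin r → Fin N → ZMod 3),
        3 * W.card + 3 * (N / Nat.log 2 N ^ E) ≤ N →
        (∀ k i m, ℓ k i m = ∑ t, a k i t * c t m + rem k i m) →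
        GradedSpreadOff W c (fun j =>
          N / Nat.log 2 N ^ E + (Nat.log 2 N) ^ (2 * C + E) * (50 * (j.val + 1) + D * Nat.log 2 N)) →
        (∀ k, ((univ : Finset (Fin r)).biUnion fun i => suppOff W (rem k i)).card + 2 ≤ (Nat.log 2 N) ^ C) →
          ((univ.filter fun x : Fin N → Bool =>
              OddZeros x ∧ RingHLF.Rel x (fun k => xor (tGuess x k) (F k (fun i => linVal (ℓ k i) x)))).card : ℝ)
            ≤ θ * (2 : ℝ) ^ (N - 1) := by
  obtain ⟨θ, hθ, hall⟩ := seedJuntaHardXS_slack E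
  refine ⟨θ, hθ, fun C => ?_⟩
  obtain ⟨D, n₀, hD⟩ := hall C
  refine ⟨D, n₀, fun N hN W r ℓ F R c a rem hW hdec hspread hr => ?_⟩
  -- the juntas: tolerance set, canonical-guess letters, off-`W` remainder supports
  set T : Fin N → Finset (Fin N) := fun k =>
    ((univ : Finset (Fin r)).biUnion fun i => suppOff W (rem k i)) ∪ W ∪ {k, nxt k} with hTdef
  have hT : ∀ k, (T k \ W).card ≤ (Nat.log 2 N) ^ C := fun k =>
    (card_union_tol_pair_sdiff_le _ W k).trans (hr k)
  have hmemT : ∀ (k : Fin N) (i : Fin r), ∀ m ∈ suppOff W (rem k i) ∪ W, m ∈ T k := by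
    intro k i m hm
    rw [mem_union] at hm
    rcases hm with hm | hm
    · exact mem_union_left _ (mem_union_left _ (mem_biUnion.mpr ⟨i, mem_univ _, hm⟩))
    · exact mem_union_left _ (mem_union_right _ hm)
  have hkT : ∀ k : Fin N, k ∈ T k := fun k => by simp [hTdef]
  have hkT' : ∀ k : Fin N, nxt k ∈ T k := fun k => by simp [hTdef]
  have hH : ∀ k (v : Fin R → ZMod 3) (x x' : Fin N → Bool), (∀ m ∈ T k, x m = x' m) →
      xor (tGuess x k) (F k (fun i => ∑ t, a k i t * v t + linVal (rem k i) x))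
        = xor (tGuess x' k) (F k (fun i => ∑ t, a k i t * v t + linVal (rem k i) x')) := by
    intro k v x x' hxx'
    rw [tGuess_congr k (hxx' k (hkT k)) (hxx' (nxt k) (hkT' k))]
    congr 2
    funext i
    rw [linVal_readsOnly W (rem k i) x x' fun m hm => hxx' m (hmemT k i m hm)]
  have h := hD N hN W R c T
    (fun k v x => xor (tGuess x k) (F k (fun i => ∑ t, a k i t * v t + linVal (rem k i) x))) hW hspread hT hH
  have hlin : ∀ (k : Fin N) (i : Fin r) (x : Fin N → Bool),
      linVal (ℓ k i) x = ∑ t, a k i t * LinForms.resVec c x t + linVal (rem k i) x :=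
    fun k i x => linVal_decomp c (a k i) (rem k i) (ℓ k i) (hdec k i) x
  have hset : (univ.filter fun x : Fin N → Bool =>
        OddZeros x ∧ RingHLF.Rel x (fun k => xor (tGuess x k) (F k (fun i => linVal (ℓ k i) x))))
      = univ.filter fun x : Fin N → Bool => OddZeros x ∧ RingHLF.Rel x (fun k =>
          xor (tGuess x k) (F k (fun i => ∑ t, a k i t * LinForms.resVec c x t + linVal (rem k i) x))) := by
    refine filter_congr fun x _ => ?_
    simp only [hlin]
  rw [hset]
  exact h

/-! ## §2 WALK coordinates, charge `n + 2`: the class of `BlockFibre37.PerOutputFormsHardConst` -/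

open scoped Classical in
/-- ★ **(J3) IN WALK COORDINATES, STRUCTURED BRANCH — UNCONDITIONAL (slack form, charge `n + 2`).**  For every `E`: ONE `θ < 1`, and for every
`C` constants `D, n₀`, such that for `n ≥ n₀` (`N := n + 1` outputs/letters): every (J3)-strategy `u ↦ (F g (gateSum (ℓ g i) u)_{i<r})_g` of
`BlockFibre37.PerOutputFormsHardConst`'s class (gate sums `Σ_m [xOfU u m]·ℓ g i m` written out) whose private forms decompose as
`ℓ_{g,i} = Σ_t a_{g,i,t} c_t + rem_{g,i}` with `c` graded-spread outside `W` (`3·#W + 3·N/(log₂N)^E ≤ N`) under the slack schedule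
`N/(log₂N)^E + (log₂N)^{2C+E}·(50(j+1) + D·log₂N)` and `#(⋃_i supp rem_{g,i} ∖ W) + 2 ≤ (log₂N)^C` for every `g`, WINS the walk game at the ring
charge `n + 2` on at most `θ·2ⁿ` inputs `u`.  Transport of `perOutputForms_structured_slackX` (`card_filter_le_card_odd`, `rel_iff_ringWinU`). -/
theorem perOutputForms_structured_slack_walk (E : ℕ) :
    ∃ θ : ℝ, θ < 1 ∧ ∀ C : ℕ, ∃ D n₀ : ℕ, ∀ n ≥ n₀,
      ∀ (W : Finset (Fin (n + 1))) (r : ℕ) (ℓ : Fin (n + 1) → Fin r → Fin (n + 1) → ZMod 3)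
        (F : Fin (n + 1) → (Fin r → ZMod 3) → Bool)
        (R : ℕ) (c : Fin R → Fin (n + 1) → ZMod 3) (a : Fin (n + 1) → Fin r → Fin R → ZMod 3)
        (rem : Fin (n + 1) → Fin r → Fin (n + 1) → ZMod 3),
        3 * W.card + 3 * ((n + 1) / Nat.log 2 (n + 1) ^ E) ≤ n + 1 →
        (∀ g i m, ℓ g i m = ∑ t, a g i t * c t m + rem g i m) →
        GradedSpreadOff W c (fun j =>
          (n + 1) / Nat.log 2 (n + 1) ^ E + (Nat.log 2 (n + 1)) ^ (2 * C + E) * (50 * (j.val + 1) + D * Nat.log 2 (n + 1))) →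
        (∀ g, ((univ : Finset (Fin r)).biUnion fun i => suppOff W (rem g i)).card + 2 ≤ (Nat.log 2 (n + 1)) ^ C) →
          ((univ.filter fun u : Fin n → Bool =>
              ringWinU (n + 2) (fun g u => F g (fun i => ∑ m : Fin (n + 1), if xOfU u m = true then ℓ g i m else 0)) u
                = true).card : ℝ) ≤ θ * (2 : ℝ) ^ n := by
  classical
  obtain ⟨θ, hθ, hall⟩ := perOutputForms_structured_slackX E
  refine ⟨θ, hθ, fun C => ?_⟩
  obtain ⟨D, n₀, hD⟩ := hall C
  refine ⟨D, max n₀ 2, fun n hn W r ℓ F R c a rem hW hdec hspread hr => ?_⟩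
  have hn₀ : n₀ ≤ n + 1 := by have := le_max_left n₀ 2; omega
  have hn2 : 2 ≤ n := le_trans (le_max_right _ _) hn
  -- the x-frame strategy and its transported walk strategy
  set z : (Fin (n + 1) → Bool) → (Fin (n + 1) → Bool) :=
    fun x k => xor (tGuess x k) (F k (fun i => linVal (ℓ k i) x)) with hz
  have hx := hD (n + 1) hn₀ W r ℓ F R c a rem hW hdec hspread hr
  rw [Nat.add_sub_cancel] at hx
  set y : Fin (n + 1) → (Fin n → Bool) → Bool :=
    fun g u => F g (fun i => ∑ m : Fin (n + 1), if xOfU u m = true then ℓ g i m else 0) with hy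
  have hy' : (fun (g : Fin (n + 1)) (u : Fin n → Bool) => xor (z (xOfU u) g) (tGuess (xOfU u) g)) = y := by
    funext g u
    have e : (fun i => linVal (ℓ g i) (xOfU u)) = fun i => ∑ m : Fin (n + 1), if xOfU u m = true then ℓ g i m else 0 := rfl
    simp only [hz, hy, ← e]
    generalize tGuess (xOfU u) g = t
    generalize F g (fun i => linVal (ℓ g i) (xOfU u)) = d
    cases t <;> cases d <;> rfl
  -- count transfer through the chart
  have h1 := card_filter_le_card_odd hn2 (fun u : Fin n → Bool => ringWinU (n + 2) y u = true)
  have h2 : (univ.filter fun x : Fin (n + 1) → Bool =>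
        (univ.filter fun j : Fin (n + 1) => x j = false).card % 2 = 1 ∧ ringWinU (n + 2) y (uVec x) = true)
      ⊆ univ.filter fun x : Fin (n + 1) → Bool => OddZeros x ∧ RingHLF.Rel x (z x) := by
    intro x hx'
    rw [mem_filter] at hx' ⊢
    refine ⟨mem_univ _, hx'.2.1, ?_⟩
    rw [rel_iff_ringWinU hn2 x hx'.2.1 z, hy']
    exact hx'.2.2
  have h3 := h1.trans (Finset.card_le_card h2)
  calc ((univ.filter fun u : Fin n → Bool => ringWinU (n + 2) y u = true).card : ℝ)
      ≤ ((univ.filter fun x : Fin (n + 1) → Bool => OddZeros x ∧ RingHLF.Rel x (z x)).card : ℝ) := by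
        exact_mod_cast h3
    _ ≤ θ * (2 : ℝ) ^ n := hx

end GradedSeeds38

end Summit.QuantumAdvantage.AdviceFreeQNC0

end
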